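import Mathlib
import HarnessLib
import Summits.AtomisticToContinuum.FouriersLaw.Theses.JunctionLocality
import Literature.MathematicalPhysics.KineticTheory.LangevinChainGibbs
import Summits.AtomisticToContinuum.FouriersLaw.Theorems.JunctionLocalitySuperadditiveResistanceStubInsertionIdentity
import Summits.AtomisticToContinuum.FouriersLaw.Theorems.JunctionLocalitySuperadditiveResistanceFarTransmissionHelpers
import Summits.AtomisticToContinuum.FouriersLaw.Theorems.JunctionLocalityInsertionCore
import Summits.AtomisticToContinuum.FouriersLaw.Theorems.JunctionLocalitySuperadditiveResistanceKuboFrame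

/-!
# Line `thermalise-then-cut-probe-insertion` — the TRANSFER THEOREM (crux `JunctionLocality.SuperadditiveResistance`,
stmt-AtomisticToContinuum-11748, skeleton v3; lead prover-line-stmt-AtomisticToContinuum-11748-0, 2026-08-16)

Kernel-checked composition of the line, landed so that it is importable: the six OPEN registered stubs of skeleton v3
(`Cruxes/SuperadditiveResistance/Lines/thermalise_then_cut_probe_insertion.lean`) — two fixed-`N` packages
(`stub_linearResponsePlain` ⇐ item stmt-AtomisticToContinuum-12237 by `linearResponsePlain_of_responseIdentity`, p92444;
`stub_kuboFrame` ⇐ existence of the device's terminal forward fields by `stub_kuboFrame_of_forwardFields`, p92239) and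
four N-UNIFORM junction bets (`stub_junctionRoughness`, `stub_junctionCurvature`, `stub_terminationLocalityTC`,
`stub_farTransmission`; no printed source — each is an odd-sector locality statement about EQUILIBRIUM response fields at
≤ 2 thermostatted sites of `pinnedChain`, re-localising the macro-ergodicity input) — taken as HYPOTHESES, spelled out
verbatim (no definitions, no named facts: the bets are conjectures of this line, not literature), imply the crux decl BY
NAME with the constant `C = 4c + 4K + 4K(1+c) + 2`, `K = γ²√(C₂⁺C₃⁺)`, `c = max(c_TL, c_FT, 0)`. Ingredients: the landed
insertion identity over the Kubo frame (`insertionIdentity_of_kuboFrame`, p91006 ← `InsertionToolbox.Assembly.insertion_core`,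
p89064), the Dirichlet principle for the floating node and the Onsager algebra (vocabulary module p90116), and the unsigned
real-analysis core `FarTransmission.core_estimate_unsigned` (p74848). This file is the line's "closed modulo X" statement:
X = {ResponseIdentity (stmt-12237), deviceForwardFields_exist (network Cuneo–Eckmann–Hairer–Rey-Bellet 2018 Thm 2.13, not in
tree), and the four N-uniform bets}.
-/

noncomputable section

open MeasureTheory Filter Topology ProbabilityTheory
open scoped ContDiff NNReal
open Literature.MathematicalPhysics.KineticTheory.HeatConduction

namespace Summit.AtomisticToContinuum.FouriersLaw.Cruxes.SuperadditiveResistance.ThermaliseThenCutProbeInsertion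

namespace Transfer

/-- Cauchy–Schwarz bookkeeping of the α-leg: from the squared identity bound and the two size
bets to `Δ ≤ γ²√(C₂⁺C₃⁺)·s·G`. -/
theorem insertion_bound {Δ γ cu ro C₃ C₂ s G : ℝ} (hs : 0 ≤ s) (hG : 0 ≤ G)
    (hro0 : 0 ≤ ro) (h : Δ ^ 2 ≤ γ ^ 4 * cu * ro) (hcu : cu ≤ C₃ * s ^ 2)
    (hro : ro ≤ C₂ * G ^ 2) :
    Δ ≤ γ ^ 2 * Real.sqrt (max C₂ 0 * max C₃ 0) * s * G := by
  have hcu' : cu ≤ max C₃ 0 * s ^ 2 :=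
    hcu.trans (mul_le_mul_of_nonneg_right (le_max_left _ _) (sq_nonneg _))
  have hro' : ro ≤ max C₂ 0 * G ^ 2 :=
    hro.trans (mul_le_mul_of_nonneg_right (le_max_left _ _) (sq_nonneg _))
  have hprod : cu * ro ≤ (max C₃ 0 * s ^ 2) * (max C₂ 0 * G ^ 2) :=
    mul_le_mul hcu' hro' hro0 (by positivity)
  have hγ4 : 0 ≤ γ ^ 4 := by positivity
  have hsq : Real.sqrt (max C₂ 0 * max C₃ 0) ^ 2 = max C₂ 0 * max C₃ 0 :=
    Real.sq_sqrt (by positivity)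
  have h2 : Δ ^ 2 ≤ (γ ^ 2 * Real.sqrt (max C₂ 0 * max C₃ 0) * s * G) ^ 2 := by
    calc Δ ^ 2 ≤ γ ^ 4 * cu * ro := h
      _ = γ ^ 4 * (cu * ro) := by ring
      _ ≤ γ ^ 4 * ((max C₃ 0 * s ^ 2) * (max C₂ 0 * G ^ 2)) :=
          mul_le_mul_of_nonneg_left hprod hγ4
      _ = (γ ^ 2 * Real.sqrt (max C₂ 0 * max C₃ 0) * s * G) ^ 2 := by
          rw [show (γ ^ 2 * Real.sqrt (max C₂ 0 * max C₃ 0) * s * G) ^ 2 =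
              γ ^ 4 * Real.sqrt (max C₂ 0 * max C₃ 0) ^ 2 * s ^ 2 * G ^ 2 by ring, hsq]
          ring
  have hnn : 0 ≤ γ ^ 2 * Real.sqrt (max C₂ 0 * max C₃ 0) * s * G := by positivity
  exact le_trans (le_abs_self Δ) (abs_le_of_sq_le_sq h2 hnn)

/-- **TRANSFER THEOREM of the line.** The six open stubs of skeleton v3, as hypotheses (verbatim statements:
`hLRp` = stub_linearResponsePlain, `hLRd` = stub_kuboFrame, `hRO` = stub_junctionRoughness, `hCU` = stub_junctionCurvature,
`hTL` = stub_terminationLocalityTC, `hFT` = stub_farTransmission), imply `JunctionLocality.SuperadditiveResistance` BY NAME. -/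
theorem superadditiveResistance_of_lineBets :
    (∀ (ω₂ lam β γ : ℝ) (μ : (N : ℕ) → ℝ → ℝ → Measure (PhaseSpace N)) (T : ℝ) (D : ℕ → ℝ),
        CruxFrame ω₂ lam β γ μ T D →
        ∀ L : ℕ, 2 ≤ L → ∃ h : PhaseSpace L → ℝ,
            PlainFrame (pinnedChain ω₂ lam β γ) T L h (D L / ((L : ℝ) - 1))) →
    (∀ (ω₂ lam β γ T : ℝ), 0 < ω₂ → 0 < lam → 0 < β → 0 < γ → 0 < T →
        ∀ N M : ℕ, 2 ≤ N → 2 ≤ M →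
          ∃ (g : Fin 4 → Fin 4 → ℝ) (gb₁ gb₄ : PhaseSpace (N + M) → ℝ),
            KuboFrame (pinnedChain ω₂ lam β γ) T N M g gb₁ gb₄) →
    (∀ (ω₂ lam β γ : ℝ) (μ : (N : ℕ) → ℝ → ℝ → Measure (PhaseSpace N)) (T : ℝ) (D : ℕ → ℝ),
        CruxFrame ω₂ lam β γ μ T D →
        ∃ C₂ : ℝ, ∀ N M : ℕ, 2 ≤ N → 2 ≤ M →
          ∀ (h : PhaseSpace (N + M) → ℝ) (g : Fin 4 → Fin 4 → ℝ)
            (gb₁ gb₄ : PhaseSpace (N + M) → ℝ),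
            PlainFrame (pinnedChain ω₂ lam β γ) T (N + M) h (D (N + M) / ((N : ℝ) + (M : ℝ) - 1)) →
            KuboFrame (pinnedChain ω₂ lam β γ) T N M g gb₁ gb₄ →
            roughness (pinnedChain ω₂ lam β γ) T N M (fun x => h x - floatTemp g * eK T N M x) ≤
              C₂ * (D (N + M) / ((N : ℝ) + (M : ℝ) - 1)) ^ 2) →
    (∀ (ω₂ lam β γ T : ℝ), 0 < ω₂ → 0 < lam → 0 < β → 0 < γ → 0 < T →
        ∃ C₃ : ℝ, ∀ N M : ℕ, 2 ≤ N → 2 ≤ M →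
          ∀ (g : Fin 4 → Fin 4 → ℝ) (gb₁ gb₄ : PhaseSpace (N + M) → ℝ),
            KuboFrame (pinnedChain ω₂ lam β γ) T N M g gb₁ gb₄ →
            curvature (pinnedChain ω₂ lam β γ) T N M gb₁ ≤ C₃ * selfLeft g ^ 2 ∧
            curvature (pinnedChain ω₂ lam β γ) T N M gb₄ ≤ C₃ * selfRight g ^ 2) →
    (∀ (ω₂ lam β γ : ℝ) (μ : (N : ℕ) → ℝ → ℝ → Measure (PhaseSpace N)) (T : ℝ) (D : ℕ → ℝ),
        CruxFrame ω₂ lam β γ μ T D →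
        (∀ L : ℕ, 2 ≤ L → ∃ h : PhaseSpace L → ℝ,
            PlainFrame (pinnedChain ω₂ lam β γ) T L h (D L / ((L : ℝ) - 1))) →
        ∃ c : ℝ, ∀ N M : ℕ, 2 ≤ N → 2 ≤ M →
          ∀ (g : Fin 4 → Fin 4 → ℝ) (gb₁ gb₄ : PhaseSpace (N + M) → ℝ),
            KuboFrame (pinnedChain ω₂ lam β γ) T N M g gb₁ gb₄ →
            selfLeft g ≤ D N / ((N : ℝ) - 1) * (1 + c * (D N / ((N : ℝ) - 1))) ∧
            selfRight g ≤ D M / ((M : ℝ) - 1) * (1 + c * (D M / ((M : ℝ) - 1)))) →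
    (∀ (ω₂ lam β γ : ℝ) (μ : (N : ℕ) → ℝ → ℝ → Measure (PhaseSpace N)) (T : ℝ) (D : ℕ → ℝ),
        CruxFrame ω₂ lam β γ μ T D →
        (∀ L : ℕ, 2 ≤ L → ∃ h : PhaseSpace L → ℝ,
            PlainFrame (pinnedChain ω₂ lam β γ) T L h (D L / ((L : ℝ) - 1))) →
        ∃ c : ℝ, ∀ N M : ℕ, 2 ≤ N → 2 ≤ M →
          ∀ (g : Fin 4 → Fin 4 → ℝ) (gb₁ gb₄ : PhaseSpace (N + M) → ℝ),
            KuboFrame (pinnedChain ω₂ lam β γ) T N M g gb₁ gb₄ →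
            bypass g ≤ c * (D N / ((N : ℝ) - 1)) * (D M / ((M : ℝ) - 1))) →
    Summit.AtomisticToContinuum.FouriersLaw.Theses.JunctionLocality.SuperadditiveResistance := by
  intro hLRp hLRd hRO hCU hTL hFT
  have hID := insertionIdentity_of_kuboFrame
  intro ω₂ lam β γ hω hl hβ hγ hU μ hμ T hT D hD hpos
  have hF : CruxFrame ω₂ lam β γ μ T D := ⟨hω, hl, hβ, hγ, hU, hμ, hT, hD, hpos⟩
  have hPlain := hLRp ω₂ lam β γ μ T D hF
  have hDev := hLRd ω₂ lam β γ T hω hl hβ hγ hT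
  obtain ⟨C₂, hC₂⟩ := hRO ω₂ lam β γ μ T D hF
  obtain ⟨C₃, hC₃⟩ := hCU ω₂ lam β γ T hω hl hβ hγ hT
  obtain ⟨c₁, hc₁⟩ := hTL ω₂ lam β γ μ T D hF hPlain
  obtain ⟨c₂, hc₂⟩ := hFT ω₂ lam β γ μ T D hF hPlain
  -- uniform constants
  obtain ⟨c, hc_def⟩ : ∃ c : ℝ, c = max (max c₁ c₂) 0 := ⟨_, rfl⟩
  obtain ⟨K, hK_def⟩ : ∃ K : ℝ, K = γ ^ 2 * Real.sqrt (max C₂ 0 * max C₃ 0) := ⟨_, rfl⟩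
  have hc0 : 0 ≤ c := by rw [hc_def]; exact le_max_right _ _
  have hcc₁ : c₁ ≤ c := by rw [hc_def]; exact le_trans (le_max_left _ _) (le_max_left _ _)
  have hcc₂ : c₂ ≤ c := by rw [hc_def]; exact le_trans (le_max_right _ _) (le_max_left _ _)
  have hK0 : 0 ≤ K := by rw [hK_def]; positivity
  refine ⟨4 * c + 4 * K + 4 * K * (1 + c) + 2, ?_⟩
  intro N M hN hM
  -- the response field of the whole chain and the device data of this split
  obtain ⟨h, hPF⟩ := hPlain (N + M) (by omega)
  obtain ⟨g, gb₁, gb₄, hDF⟩ := hDev N M hN hM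
  have hcast : ((N + M : ℕ) : ℝ) - 1 = (N : ℝ) + (M : ℝ) - 1 := by push_cast; ring
  rw [hcast] at hPF
  -- conductances of the whole and of the pieces
  obtain ⟨gL, hgL⟩ : ∃ gL : ℝ, gL = D (N + M) / ((N : ℝ) + (M : ℝ) - 1) := ⟨_, rfl⟩
  obtain ⟨gN, hgN⟩ : ∃ gN : ℝ, gN = D N / ((N : ℝ) - 1) := ⟨_, rfl⟩
  obtain ⟨gM, hgM⟩ : ∃ gM : ℝ, gM = D M / ((M : ℝ) - 1) := ⟨_, rfl⟩
  have hN' : (2 : ℝ) ≤ (N : ℝ) := by exact_mod_cast hN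
  have hM' : (2 : ℝ) ≤ (M : ℝ) := by exact_mod_cast hM
  have hgN0 : 0 < gN := by rw [hgN]; exact div_pos (hpos N hN) (by linarith)
  have hgM0 : 0 < gM := by rw [hgM]; exact div_pos (hpos M hM) (by linarith)
  have hgL0 : 0 < gL := by rw [hgL]; exact div_pos (hpos (N + M) (by omega)) (by linarith)
  have hrough := hC₂ N M hN hM h g gb₁ gb₄ hPF hDF
  rw [← hgL] at hPF hrough
  have hsym : ∀ a b, g a b = g b a := hDF.1
  have hpsd : ∀ θ, 0 ≤ dirichletForm g θ := hDF.2.1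
  have ha0 : 0 ≤ selfLeft g := selfLeft_nonneg hsym hpsd
  have hb0 : 0 ≤ selfRight g := selfRight_nonneg hsym hpsd
  -- α-LEG: the identity at the floating temperature, from both ends, with the two size bets
  obtain ⟨h1, h4⟩ :=
    hID ω₂ lam β γ T hω hl hβ hγ hT N M hN hM h gL g gb₁ gb₄ hPF hDF (floatTemp g)
  obtain ⟨hcurv₁, hcurv₄⟩ := hC₃ N M hN hM g gb₁ gb₄ hDF
  have hro0 : 0 ≤ roughness (pinnedChain ω₂ lam β γ) T N M
      (fun x => h x - floatTemp g * eK T N M x) := integral_nonneg fun _ => sq_nonneg _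
  have hα₁ : gL - deviceConductance g ≤ K * selfLeft g * gL := by
    rw [hK_def]
    refine insertion_bound ha0 hgL0.le hro0 ?_ hcurv₁ hrough
    calc (gL - deviceConductance g) ^ 2 = (sideOne g (floatTemp g) - gL) ^ 2 := by
          unfold deviceConductance; ring
      _ ≤ _ := h1
  have hα₄ : gL - deviceConductance g ≤ K * selfRight g * gL := by
    rw [hK_def]
    refine insertion_bound hb0 hgL0.le hro0 ?_ hcurv₄ hrough
    calc (gL - deviceConductance g) ^ 2 = (sideFour g (floatTemp g) - gL) ^ 2 := by
          rw [sideFour_floatTemp hsym hpsd]; ring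
      _ ≤ _ := h4
  have hα : gL - deviceConductance g ≤ K * min (selfLeft g) (selfRight g) * gL := by
    rcases min_choice (selfLeft g) (selfRight g) with hmin | hmin <;> rw [hmin]
    · exact hα₁
    · exact hα₄
  -- β-LEG: the Dirichlet principle and the one-sided termination/transmission bets
  have hDir := deviceConductance_le hsym hpsd
  obtain ⟨hTLa, hTLb⟩ := hc₁ N M hN hM g gb₁ gb₄ hDF
  have hxup := hc₂ N M hN hM g gb₁ gb₄ hDF
  rw [← hgN] at hTLa hxup
  rw [← hgM] at hTLb hxup
  have ha : selfLeft g ≤ gN * (1 + c * gN) :=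
    hTLa.trans (mul_le_mul_of_nonneg_left
      ((add_le_add_iff_left 1).mpr (mul_le_mul_of_nonneg_right hcc₁ hgN0.le)) hgN0.le)
  have hb : selfRight g ≤ gM * (1 + c * gM) :=
    hTLb.trans (mul_le_mul_of_nonneg_left
      ((add_le_add_iff_left 1).mpr (mul_le_mul_of_nonneg_right hcc₁ hgM0.le)) hgM0.le)
  have hx : bypass g ≤ c * gN * gM :=
    hxup.trans (mul_le_mul_of_nonneg_right (mul_le_mul_of_nonneg_right hcc₂ hgN0.le) hgM0.le)
  -- the real-analysis core
  have key := FarTransmission.core_estimate_unsigned' hgN0 hgM0 hgL0 hK0 hc0 ha hb hx hα hDir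
  rw [hgN, hgM, hgL, one_div_div, one_div_div, one_div_div] at key
  exact key


end Transfer

end Summit.AtomisticToContinuum.FouriersLaw.Cruxes.SuperadditiveResistance.ThermaliseThenCutProbeInsertion

end
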